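import Mathlib
import HarnessLib
import Summits.Ventures.CertifiedManyBodySolver.Theses.M3PrimeEdgeSplit
import Literature.MathematicalPhysics.QuantumLattice.HubbardNNNHoppingWindowCertificateD4
import Summits.Ventures.CertifiedManyBodySolver.Theorems.M3PrimeEdgeSplitLowerEdge_ge_m4o5SlackAbsorb

/-!
# Line `fo-dual-rounding` (rev 4) — a kernel-level SLACK READER for first-order duals with rigorous rounding
(crux-plan skeleton for `M3PrimeEdgeSplit.LowerEdge_ge_m4o5`; team lb-dual, cell hub-lb; planner hub-lb-dual-plan-2 g0, rev 4 by g1)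
(= stmt-Ventures-21721; −83/100 twin for stmt-Ventures-22024 at `Cruxes/LowerEdge_ge_m83o100/Lines/fo_dual_rounding.lean`)
HONEST FRAMING: a skeleton is a typed plan with sorried stubs, not a bound. No summit statement is proved
here; the only certified M3 lower row at `t' = 0` remains CERTIFIED #529 (`lo = −0.8295699476`, first-order
ADMM dual + exact repair, a claim node), `0.0296` below `−4/5` and `4.3·10⁻⁴` above `−83/100`. Nothing here
predicts superconductivity.

REV 4 (2026-08-28, hub-lb-dual-plan-2 g1) = THE ONE PERMITTED RE-REGISTRATION (captain ruling «skeleton of record =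
status quo frozen», cell STATUS 06:28:34Z, obligation O1; recipe hub-lb-sym-eng-3 07:49:48Z): the two SOUNDNESS stubs
are DISCHARGED by theorems now LANDED in `Theorems/` — `stub_wardWindowSound := Theorems.WardSlot.stub_wardWindowSound`
(p612283; proof term `Literature…HubbardNNNHoppingWindowCertificateWardD4TL.energyDensityTT'_ge_of_wardD4_window_certificate`,
W1∘W2∘W3 landed by hub-lb-sym-eng-3, statement text = hub-lb-sym-plan-2's `wardk`, first sorry-free chain = hub-lb-
dual-plan-1's `dualreplay`) and `stub_slackAbsorb := Theorems.WardSlot.stub_slackAbsorb` (p613156; proof = hub-lb-sym-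
ref-1's `SlackAbsorb.lean` 8686c191df574d56, landed verbatim by sym-eng-3). Both landed statements are VERBATIM (rfl-
equal) copies of §1 below (hub-lb-dual-ref-2 `BindO2.lean` 34d72a1f2b42d62c: four `rfl` + composition, axioms
{propext, Classical.choice, Quot.sound}), so the discharge is by definitional unfolding. NOTHING ELSE CHANGED: §1 is
byte-identical to rev 3 (sha 94f99bf03038), stub 3 (`stub_nearCert_m4o5`, name · signature · docstring) is byte-
identical, §3's composition is unchanged. After rev 4 the REGISTERED STUB SET is {`stub_nearCert_m4o5`} — the VALUE
stub — and nothing generic remains for a prover on this item: 21721 is a VALUE problem (+0.0296 over #529; no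
certificate ≥ −4/5 exists at any footprint the engines hold, F3′a NO-GO of record).

REV 3 = the cell's two rulings applied to rev 2:
* RULING (crit-3 VERDICT-3 #3 (C) 05:37:33Z; crit-1 owner record 05:40:18Z/05:40:45Z): the `SU(2)`-Ward slot is
  ONE Lean text — pen sym-plan-2, line `wardk` (W1 generic-sector torus certificate, W2 Ward × `D₄` torus theorem on
  the `N`-particle sector, W3 torus → TL); dual-plan-2 DROPS its own Ward theorem and IMPORTS that one. Done here:
  `WardD4Identity` and `WardD4WindowSound` below are VERBATIM copies of wardk.lean's (sha256/12 of the copied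
  source text: `f37c52ff543c` / `82619db2fd6a`), kept as local defs ONLY because `Cruxes/…/Lines/*.lean` workfiles are not
  importable modules on the farm (`lean check` → rc 75 `unbuilt:….Lines.wardk`); the single stub
  `stub_wardWindowSound : WardD4WindowSound` is «wardk W1∘W2∘W3» and is discharged by ONE line (`exact` that
  theorem) the day wardk's text lands in `Theorems/` or `Literature/`. No second Ward theorem is filed.
* S-R2 (dual-ref-2 05:43:25Z, CERT-SDP §2.3′ (τ1)/(τ3)): the slack charge must name its normalisation. Done here:
  the Gram generators `O k i` are ARBITRARY window operators shipped WITH weights `r k i` and SOS proofs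
  `(r k i)² • 1 − (O k i)ᴴ (O k i) ⪰ 0` (i.e. `‖O k i‖ ≤ r k i`), and a PSD floor `δ_k` on block `k` costs EXACTLY
  `δ_k · Σ_i (r k i)²` — (τ1) ladder words: `r = 1` (`norm_ladderWord_le_one`), cost `δ_k · dim_k`; (τ3) integer-
  adapted `D₄ × SU(2)hw` generators `b_i = Σ_w B_iw w`: `r_i = ‖B_i‖₁`, cost `δ_k · Σ_i ‖B_i‖₁²`; mode gram (exact
  `LᴴL`, certc K40, #529): `δ = 0`, no charge. `τ` is certificate DATA, never an assumption of the reader.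

THE LINE. wardk's reader (`WardD4WindowSound`) is, like the tree's `energyDensityTT'_ge_of_window_certificate_d4`,
an ANY-TIME bound — any multipliers give `c − Σₖ ‖aₖ‖ ≤ e(t,t',U,n)` (pdopt `E(z) = −b·z − ‖q + Aᵀz‖₁`, certsdp
`bound = c₀ + p[norm] + λ·b − Σ|pᵢ|ρᵢ`) — but it wants the Gram multiplier EXACTLY PSD. The Jansson–Chaykin–Keil
mechanism (`Literature.Computation.Certificates.JanssonChaykinKeil.lmiForm_bound`: a multiplier PSD only up to a
certified `λ_min`-enclosure `−δ` still certifies, at the a-priori primal cost `δ ·` (trace bound)) has no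
counterpart in any tree or wardk window theorem. `stub_slackAbsorb` adds it: with it a ROUNDED FIRST-ORDER DUAL
ITERATE (exact-ℚ multipliers, a PSD floor `−δ_k` per block from an `LDLᵀ`/Gershgorin/`λ_min` enclosure, residual
in `ℓ¹`) is a certificate with NO exact Cholesky and NO interior-point solve (crit-3 δ1 option 2; certc's exact
`LLᵀ` path is the `δ = 0` instance — an alternative reader, not a prerequisite). The crux then TRANSFERS to the
finite statement `stub_nearCert_m4o5`: a near-certificate of value `≥ −4/5` exists at `(t,t',U,n) = (1,0,8,7/8)`.

STUBS (rev 4: ONE registered stub = the only sorry of this file):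
* `stub_wardWindowSound` [DISCHARGED p612283] `WardD4WindowSound` — wardk's W1∘W2∘W3, `:= Theorems.WardSlot.stub_wardWindowSound`.
* `stub_slackAbsorb`     [DISCHARGED p613156] `WardD4WindowSound → WardSlackWindowBound` — JCK Lemma 3.1, `:= Theorems.WardSlot.stub_slackAbsorb`.
* `stub_nearCert_m4o5`  [X, REGISTERED]      `NearCertWardSlack_m4o5` — the TRANSFER target `C⁺` (VALUE stub).
COMPOSITION (no sorry): `exists_lowerRow_of_stubs : stub₁ → stub₂ → stub₃ → ∃ lo ≥ −4/5, M3EnergyLowerRow 0 lo`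
and `LowerEdge_ge_m4o5_of : M3PrimeEdgeSplit.LowerEdge_ge_m4o5` — the crux BY NAME from the declared stubs.

VALUE-STUB INTERFACE (how an edition inhabits `NearCertWardSlack_m4o5`, binder by binder; glue in the tree or offered):
`_hZ` (per-block `Z k + δ_k•1 ⪰ 0`): mode gram `Z k = Lᴴ L`, `δ_k = 0` by `Matrix.posSemidef_conjTranspose_mul_self`
(certc / #529 class), or factor + max-rowsum slack `δ_k := g_k` (hub-lb-dual-plan-1 `PsdOfFactorRowsum`,
`Lines/dualreplay.lean`, proved), or exact `LDLᵀ` (`psdCheck_sound`, lb-chord); `_hO` (generator norms): ladder words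
`r = 1` (`norm_ladderWord_le_one`), symmetry-adapted ℂ-combinations `r := Σ|coeff|` (hub-lb-dual-ref-2 `G2prime.lean`
757bab12112d52b2: `hO_wordCombination`, kernel-checked, offered for verbatim landing); the IDENTITY `WardD4Identity …`
(an equation in `FermionOp Λ'`): a verified CAR normal-orderer — lb-sym `Lines/symreplay.lean` S1–S4 (`SymCheckSound :
∀ K, symCheck K = true → WardD4CertGe (symValue K)`, pen hub-lb-sym-plan-1, unregistered workfile; exact Gram, `δ = 0`)
— this is the CHECKER WORK and the binding cost (≈ 2.5×10⁸ pair normal-orderings at E₁ class, hub-lb-sym-ref-2); the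
inequality `−4/5 ≤ c − Σ‖a_k‖ − Σ_k δ_k Σ_i r²`: `norm_num` on shipped rationals. Whole-stub dischargers already PROVED in
workfiles: lb-chord `Lines/clique_sparse_sos.lean` (hub-lb-chord-plan-2) `nearCertGe_of_cliqueWardCertGe : CliqueWardCertGe q
→ NearCertWardSlackGe q` with `cliqueWardCertGe_iff : CliqueWardCertGe q ↔ WardD4CertGe q` and the monotonicity
`nearCertWardSlackGe_mono` — so ANY exact (`δ = 0`) Ward × `D₄` certificate of value `q ≥ −4/5` in wardk's sense
`WardD4CertGe q`, however produced (symreplay `SymCert`, clique-sparse SOS, certc mode gram), inhabits this stub after the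
import swap; the `δ > 0` slack is what a ROUNDED first-order iterate needs in addition. No −4/5 certificate exists; the
interface is recorded for the day one does, and serves the −83/100 twin identically.
-/

noncomputable section

namespace Summit.Ventures.CertifiedManyBodySolver.Cruxes.LowerEdge_ge_m4o5.FoDualRounding

open Matrix Finset
open Literature.MathematicalPhysics.QuantumLattice
open Literature.MathematicalPhysics.QuantumLattice.HubbardWave0
open Literature.MathematicalPhysics.QuantumLattice.ThermodynamicLimit
open Literature.Probability.LatticeModels
open Literature.MathematicalPhysics.QuantumManyBody.StateRelaxation
open scoped ComplexOrder BigOperators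

/-! ## §1 Statements -/

/-- **VERBATIM COPY of `WardK.WardD4Identity` (Cruxes/LowerEdge_ge_m4o5/Lines/wardk.lean, sym-plan-2 = pen of
record for the Ward slot).** The `SU(2)`-Ward × affine-`D₄` window identity in `𝔄_{Λ'}` for the `t–t'` Hubbard
interaction at target density `n`: ONE multiplier `μ` on the total site density and the two Ward null families
`Σ_r (S⁺_{Λ'} X_r − X_r S⁺_{Λ'})`, `Σ_r (S⁻_{Λ'} X'_r − X'_r S⁻_{Λ'})` next to the null terms of
`groundEnergy_hubbardTorusTT'_div_ge_of_window_certificate_d4`. (Local copy only because Lines workfiles are not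
importable on the farm; replace by the import when wardk lands.) -/
def WardD4Identity (t t' U n : ℝ) {Λ Λ' : Finset (Site 2)} (hΛ : Λ ⊆ Λ')
    (h0 : thicken ({0} : Finset (Site 2)) 1 ⊆ Λ') (hz : (0 : Site 2) ∈ Λ') (μ : ℝ)
    {m : Type} [Fintype m] [DecidableEq m] (Λm : Matrix m m ℂ) (O : m → FermionOp Λ')
    {κ : Type} (s : Finset κ) (B : κ → FermionOp Λ)
    {ι : Type} (tt : Finset ι) (γ : ι → DihedralGroup 4) (wv : ι → Site 2)
    (hsh : ∀ l, d4ShiftSet (γ l) (wv l) Λ ⊆ Λ') (Y : ι → FermionOp Λ)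
    {ρ : Type} (u : Finset ρ) (b : ρ → ℂ) (cw : ρ → List (Orb (PolySite Λ') × Bool))
    {θ : Type} (wp : Finset θ) (Xp : θ → FermionOp Λ')
    {θ' : Type} (wm : Finset θ') (Xm : θ' → FermionOp Λ')
    {δ : Type} (ah : Finset δ) (dc : δ → ℝ) (V : δ → FermionOp Λ')
    {κ'' : Type} (w : Finset κ'') (a : κ'' → ℂ) (word : κ'' → List (Orb (PolySite Λ') × Bool))
    (c : ℝ) : Prop :=
  fermionEmbed (PolySite.incl h0) ((hubbardTTPrimeFermionInteraction t t' U).meanEnergyObs 1) -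
      (c : ℂ) • (1 : FermionOp Λ') -
      ((μ : ℝ) : ℂ) • (nAt 0 hz 0 + nAt 0 hz 1 - ((n : ℝ) : ℂ) • (1 : FermionOp Λ')) =
    gramForm Λm O +
      (∑ k ∈ s, ((hubbardTTPrimeFermionInteraction t t' U).localHamiltonian Λ' * fermionEmbed (PolySite.incl hΛ) (B k) -
          fermionEmbed (PolySite.incl hΛ) (B k) * (hubbardTTPrimeFermionInteraction t t' U).localHamiltonian Λ') +
        ∑ l ∈ tt, (fermionEmbed (PolySite.incl (hsh l)) (fermionEmbed (PolySite.d4Emb (γ l) (wv l) Λ) (Y l)) -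
          fermionEmbed (PolySite.incl hΛ) (Y l)) +
        ∑ j ∈ u, b j • ladderWord (cw j) +
        ∑ r ∈ wp, ((spinPlus : FermionOp Λ') * Xp r - Xp r * (spinPlus : FermionOp Λ')) +
        ∑ r ∈ wm, ((spinMinus : FermionOp Λ') * Xm r - Xm r * (spinMinus : FermionOp Λ'))) +
      (∑ m' ∈ ah, ((dc m' : ℝ) : ℂ) • ((V m')ᴴ - V m') + ∑ k ∈ w, a k • ladderWord (word k))

/-- **VERBATIM COPY of `WardK.WardD4WindowSound` (wardk W3 target = W1∘W2∘W3): Ward × `D₄` window certificate ⇒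
`c − Σₖ ‖aₖ‖ ≤ energyDensityTT' t t' U n`** (`0 ≤ U`, `0 ≤ n < 2`, `thicken Λ 1 ⊆ Λ'`), Gram multiplier `Λm`
EXACTLY PSD, generators `O : m → FermionOp Λ'` arbitrary. -/
def WardD4WindowSound : Prop :=
  ∀ (t t' U : ℝ), 0 ≤ U → ∀ (n : ℝ), 0 ≤ n → n < 2 →
  ∀ (Λ Λ' : Finset (Site 2)) (hΛ : Λ ⊆ Λ') (_h8 : thicken Λ 1 ⊆ Λ')
    (h0 : thicken ({0} : Finset (Site 2)) 1 ⊆ Λ') (hz : (0 : Site 2) ∈ Λ')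
    (μ : ℝ)
    (m : Type) (_ : Fintype m) (_ : DecidableEq m) (Λm : Matrix m m ℂ) (_hΛm : Λm.PosSemidef)
    (O : m → FermionOp Λ')
    (κ : Type) (s : Finset κ) (B : κ → FermionOp Λ)
    (ι : Type) (tt : Finset ι) (γ : ι → DihedralGroup 4) (wv : ι → Site 2)
    (hsh : ∀ l, d4ShiftSet (γ l) (wv l) Λ ⊆ Λ') (Y : ι → FermionOp Λ)
    (ρ : Type) (u : Finset ρ) (b : ρ → ℂ) (cw : ρ → List (Orb (PolySite Λ') × Bool))
    (_hcw : ∀ j ∈ u, ladderCharge (cw j) ≠ 0 ∨ ladderSpinCharge (cw j) ≠ 0)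
    (θ : Type) (wp : Finset θ) (Xp : θ → FermionOp Λ')
    (θ' : Type) (wm : Finset θ') (Xm : θ' → FermionOp Λ')
    (δ : Type) (ah : Finset δ) (dc : δ → ℝ) (V : δ → FermionOp Λ')
    (κ'' : Type) (w : Finset κ'') (a : κ'' → ℂ) (word : κ'' → List (Orb (PolySite Λ') × Bool))
    (c : ℝ),
    WardD4Identity t t' U n hΛ h0 hz μ Λm O s B tt γ wv hsh Y u b cw wp Xp wm Xm ah dc V w a word c →
    c - ∑ k ∈ w, ‖a k‖ ≤ energyDensityTT' t t' U n

/-- **Statement of stub 2's conclusion — the SLACK READER (JCK Lemma 3.1 in the window algebra, normalisation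
EXPLICIT per S-R2).** Same identity `WardD4Identity`, but the Gram part is a finite FAMILY of blocks
`k : β` with multipliers `Z k` that are only NEARLY PSD — `Z k + δ_k • 1 ⪰ 0`, `0 ≤ δ_k` (a certified
`λ_min`-enclosure; `Z k` itself exact-ℚ in practice) — entered as `Λm := blockDiagonal' Z` on the generator
family `(k,i) ↦ O k i`, where every generator is shipped with a weight `r k i` and an SOS proof of
`‖O k i‖ ≤ r k i` in the form `(r k i)² • 1 − (O k i)ᴴ (O k i) ⪰ 0`. PRICE: `Σ_k δ_k · Σ_i (r k i)²`
(the state value of `(O k i)ᴴ (O k i)` is `≤ (r k i)²`). Conclusion: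
`c − Σₖ ‖aₖ‖ − Σ_k δ_k Σ_i (r k i)² ≤ energyDensityTT' t t' U n`. -/
def WardSlackWindowBound : Prop :=
  ∀ (t t' U : ℝ), 0 ≤ U → ∀ (n : ℝ), 0 ≤ n → n < 2 →
  ∀ (Λ Λ' : Finset (Site 2)) (hΛ : Λ ⊆ Λ') (_h8 : thicken Λ 1 ⊆ Λ')
    (h0 : thicken ({0} : Finset (Site 2)) 1 ⊆ Λ') (hz : (0 : Site 2) ∈ Λ')
    (μ : ℝ)
    (β : Type) (_ : Fintype β) (_ : DecidableEq β) (mb : β → Type) (_ : ∀ k, Fintype (mb k))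
    (_ : ∀ k, DecidableEq (mb k))
    (Z : (k : β) → Matrix (mb k) (mb k) ℂ) (δs : β → ℝ) (_hδ : ∀ k, 0 ≤ δs k)
    (_hZ : ∀ k, (Z k + ((δs k : ℝ) : ℂ) • (1 : Matrix (mb k) (mb k) ℂ)).PosSemidef)
    (O : (k : β) → mb k → FermionOp Λ') (r : (k : β) → mb k → ℝ)
    (_hO : ∀ k i, ((((r k i) ^ 2 : ℝ) : ℂ) • (1 : FermionOp Λ') - (O k i)ᴴ * O k i).PosSemidef)
    (κ : Type) (s : Finset κ) (B : κ → FermionOp Λ)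
    (ι : Type) (tt : Finset ι) (γ : ι → DihedralGroup 4) (wv : ι → Site 2)
    (hsh : ∀ l, d4ShiftSet (γ l) (wv l) Λ ⊆ Λ') (Y : ι → FermionOp Λ)
    (ρ : Type) (u : Finset ρ) (b : ρ → ℂ) (cw : ρ → List (Orb (PolySite Λ') × Bool))
    (_hcw : ∀ j ∈ u, ladderCharge (cw j) ≠ 0 ∨ ladderSpinCharge (cw j) ≠ 0)
    (θ : Type) (wp : Finset θ) (Xp : θ → FermionOp Λ')
    (θ' : Type) (wm : Finset θ') (Xm : θ' → FermionOp Λ')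
    (δ : Type) (ah : Finset δ) (dc : δ → ℝ) (V : δ → FermionOp Λ')
    (κ'' : Type) (w : Finset κ'') (a : κ'' → ℂ) (word : κ'' → List (Orb (PolySite Λ') × Bool))
    (c : ℝ),
    WardD4Identity t t' U n hΛ h0 hz μ (Matrix.blockDiagonal' Z) (fun p : (k : β) × mb k => O p.1 p.2)
      s B tt γ wv hsh Y u b cw wp Xp wm Xm ah dc V w a word c →
    c - ∑ k ∈ w, ‖a k‖ - ∑ k, δs k * ∑ i, (r k i) ^ 2 ≤ energyDensityTT' t t' U n

/-- **Statement of stub 3 — the transfer target `C⁺`: a NEAR-CERTIFICATE OF VALUE `≥ −4/5` EXISTS at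
`(t,t',U,n) = (1,0,8,7/8)`**, in checker normal form (all index sets finite ordinals): windows `Λ ⊆ Λ'`,
ONE total-density multiplier `μ`, Gram blocks `Z k` (`k < nb`, sizes `msz k`) with PSD floors `δ_k ≥ 0`
(`Z k + δ_k • 1 ⪰ 0`), generators `O k i` with weights `r k i` and SOS norm proofs, `[H', ·]`-, `D₄`-, charged-
word-, `S⁺`/`S⁻`-WARD- and anti-Hermitian null data, residual words with coefficients `a`, satisfying
`WardD4Identity` EXACTLY, and `−4/5 ≤ c − Σₖ ‖aₖ‖ − Σ_k δ_k Σ_i (r k i)²`. STRONGER than the crux; it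
is what the engines produce (FO dual iterate → exact-ℚ multipliers → per-block `λ_min` floor → `ℓ¹` residual). -/
def NearCertWardSlack_m4o5 : Prop :=
  ∃ (Λ Λ' : Finset (Site 2)) (hΛ : Λ ⊆ Λ') (_h8 : thicken Λ 1 ⊆ Λ')
    (h0 : thicken ({0} : Finset (Site 2)) 1 ⊆ Λ') (hz : (0 : Site 2) ∈ Λ')
    (μ : ℝ)
    (nb : ℕ) (msz : Fin nb → ℕ) (Z : (k : Fin nb) → Matrix (Fin (msz k)) (Fin (msz k)) ℂ)
    (δs : Fin nb → ℝ) (_hδ : ∀ k, 0 ≤ δs k)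
    (_hZ : ∀ k, (Z k + ((δs k : ℝ) : ℂ) • (1 : Matrix (Fin (msz k)) (Fin (msz k)) ℂ)).PosSemidef)
    (O : (k : Fin nb) → Fin (msz k) → FermionOp Λ') (r : (k : Fin nb) → Fin (msz k) → ℝ)
    (_hO : ∀ k i, ((((r k i) ^ 2 : ℝ) : ℂ) • (1 : FermionOp Λ') - (O k i)ᴴ * O k i).PosSemidef)
    (ns : ℕ) (B : Fin ns → FermionOp Λ)
    (nt : ℕ) (γ : Fin nt → DihedralGroup 4) (wv : Fin nt → Site 2)
    (hsh : ∀ l, d4ShiftSet (γ l) (wv l) Λ ⊆ Λ') (Y : Fin nt → FermionOp Λ)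
    (nu : ℕ) (b : Fin nu → ℂ) (cw : Fin nu → List (Orb (PolySite Λ') × Bool))
    (_hcw : ∀ j ∈ (Finset.univ : Finset (Fin nu)), ladderCharge (cw j) ≠ 0 ∨ ladderSpinCharge (cw j) ≠ 0)
    (np : ℕ) (Xp : Fin np → FermionOp Λ') (nm' : ℕ) (Xm : Fin nm' → FermionOp Λ')
    (na : ℕ) (dc : Fin na → ℝ) (V : Fin na → FermionOp Λ')
    (nw : ℕ) (a : Fin nw → ℂ) (word : Fin nw → List (Orb (PolySite Λ') × Bool))
    (c : ℝ),
    WardD4Identity 1 0 8 (7 / 8) hΛ h0 hz μ (Matrix.blockDiagonal' Z)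
      (fun p : (k : Fin nb) × Fin (msz k) => O p.1 p.2) Finset.univ B Finset.univ γ wv hsh Y Finset.univ b cw
      Finset.univ Xp Finset.univ Xm Finset.univ dc V Finset.univ a word c ∧
    (-4 / 5 : ℝ) ≤ c - ∑ k, ‖a k‖ - ∑ k, δs k * ∑ i, (r k i) ^ 2

/-! ## §2 Stubs — 1 and 2 DISCHARGED by landed theorems (rev 4); 3 is the ONE registered stub (the only sorry) -/

/-- **Stub 1 [DISCHARGED, rev 4] — wardk's Ward × `D₄` window soundness theorem (W1∘W2∘W3; statement pen
hub-lb-sym-plan-2; cell ruling: ONE text).** LANDED as `Theorems.WardSlot.stub_wardWindowSound` (p612283, file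
`Theorems/M3PrimeEdgeSplitLowerEdge_ge_m4o5WardWindowSound.lean`, hub-lb-sym-eng-3), whose proof term is the Literature
theorem `HubbardNNNHoppingWindowCertificateWardD4TL.energyDensityTT'_ge_of_wardD4_window_certificate` (chain
`HubbardTorusGenericSectorCertificate` W1 → `HubbardNNNHoppingWindowCertificateWardD4` W2 → `HubbardTTPrimeTorusFamilyTransport`
W3 → `…WardD4TL`, all ACCEPTED; first sorry-free in-cell chain: hub-lb-dual-plan-1 `Lines/dualreplay.lean`
`wardD4WindowSound_holds`). The landed statement is a verbatim copy of §1's `WardD4WindowSound` over a verbatim copy of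
`WardD4Identity` (hub-lb-dual-ref-2 `BindO2.lean`: `rfl`), so the term below elaborates by definitional unfolding;
axioms {propext, Classical.choice, Quot.sound}. No longer a registered stub. [cite: LiebTwoTheorems1989, Thm 2; Han2020Bootstrap, §3] -/
theorem stub_wardWindowSound : WardD4WindowSound :=
  Summit.Ventures.CertifiedManyBodySolver.Theorems.WardSlot.stub_wardWindowSound

/-- **Stub 2 [DISCHARGED, rev 4] — SLACK ABSORPTION (Jansson–Chaykin–Keil Lemma 3.1 transplanted to the window
algebra): from the exact reader to the slack reader.** LANDED as `Theorems.WardSlot.stub_slackAbsorb` (p613156, file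
`Theorems/M3PrimeEdgeSplitLowerEdge_ge_m4o5SlackAbsorb.lean`; proof = hub-lb-sym-ref-1's `SlackAbsorb.lean`
8686c191df574d56 landed verbatim by hub-lb-sym-eng-3: square roots `CFC.sqrt` of the SOS defects, the exact reader fed
with generators `Sum.elim O F` on `σ ⊕ σ`, PSD multiplier `fromBlocks (blockDiagonal' (Z k + δ_k•1)) 0 0 (diagonal δ)`
via the landed helpers `posSemidef_fromBlocks_diag` / `posSemidef_blockDiagonal'` / `gramForm_fromBlocks_diag` /
`gramForm_diagonal`, constant `c − Σ_k δ_k Σ_i r²`). The landed `WardSlackWindowBound` is a verbatim copy of §1's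
(hub-lb-sym-ref-1 text diff ∅; hub-lb-dual-ref-2 `rfl`). No longer a registered stub. [cite: JanssonChaykinKeil2008, Lemma 3.1] -/
theorem stub_slackAbsorb : WardD4WindowSound → WardSlackWindowBound :=
  fun h => Summit.Ventures.CertifiedManyBodySolver.Theorems.WardSlot.stub_slackAbsorb h

/-- **Stub 3 [X] — the near-certificate of value `≥ −4/5` at (1, 0, 8, 7/8) EXISTS.** See `NearCertWardSlack_m4o5`.
This is the object the hub-lb engines compute, at a footprint beyond the exhausted (≤3,≤3) class. Why it might
fail: the program value at every footprint the engines can hold may stay below −4/5 (CAP table: (≤3,≤3) −0.8313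
EXHAUSTED, (4,4) −0.8004, (≤3,5) −0.7826, (4,5) ≤ −0.7860, (5,5) ≈ −0.778 ± 0.006 — FLOAT values of relaxations
not yet certified; TL float −0.767 ± 0.004); and a first-order dual deep enough may not be reachable in budget
(F3′a: FO depth v* − E ≥ 6.4·10⁻⁴ un-owned at MENU after 2000 ADMM its). [cite: Han2020Bootstrap, §3; WangEtAl2024, §III] -/
theorem stub_nearCert_m4o5 : NearCertWardSlack_m4o5 := by
  sorry

/-! ## §3 The composition (kernel-checked; no sorry outside the stubs) -/

/-- **Composition, hypotheses form.** The three stub STATEMENTS give the certified lower row `lo = -4 / 5`: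
read stub 3's near-certificate with the slack reader (stub 2 applied to stub 1) at `(t,t',U,n) = (1,0,8,7/8)`.
(Concludes the unfolded statement, so that exactly ONE theorem of this file concludes the crux by name.) [folklore] -/
theorem exists_lowerRow_of_stubs :
    WardD4WindowSound → (WardD4WindowSound → WardSlackWindowBound) → NearCertWardSlack_m4o5 →
      ∃ lo : ℚ, (-4 / 5 : ℚ) ≤ lo ∧ Summit.Ventures.CertifiedManyBodySolver.M3EnergyLowerRow 0 lo := by
  intro h₁ h₂ h₃
  have hS : WardSlackWindowBound := h₂ h₁
  obtain ⟨Λ, Λ', hΛ, h8, h0, hz, μ, nb, msz, Z, δs, hδ, hZ, O, r, hO, ns, B, nt, γ, wv, hsh, Y, nu, b, cw, hcw,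
    np, Xp, nm', Xm, na, dc, V, nw, a, word, c, hcert, hval⟩ := h₃
  have hb := hS 1 0 8 (by norm_num) (7 / 8) (by norm_num) (by norm_num) Λ Λ' hΛ h8 h0 hz μ
    (Fin nb) inferInstance inferInstance (fun k => Fin (msz k)) inferInstance inferInstance Z δs hδ hZ O r hO
    (Fin ns) Finset.univ B (Fin nt) Finset.univ γ wv hsh Y (Fin nu) Finset.univ b cw hcw
    (Fin np) Finset.univ Xp (Fin nm') Finset.univ Xm (Fin na) Finset.univ dc V (Fin nw) Finset.univ a word c hcert
  refine ⟨-4 / 5, le_rfl, ?_⟩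
  unfold Summit.Ventures.CertifiedManyBodySolver.M3EnergyLowerRow
  have hcast : (((-4 / 5 : ℚ) : ℚ) : ℝ) = (-4 / 5 : ℝ) := by push_cast; ring
  rw [hcast]
  linarith

/-- **THE SKELETON THEOREM.** The crux `M3PrimeEdgeSplit.LowerEdge_ge_m4o5` — BY NAME — from the three stub theorems
`stub_wardWindowSound`, `stub_slackAbsorb` (both DISCHARGED by landed theorems since rev 4) and `stub_nearCert_m4o5`
(the ONE registered stub = the only sorry of this file) through `exists_lowerRow_of_stubs`. [folklore] -/
theorem LowerEdge_ge_m4o5_of : Summit.Ventures.CertifiedManyBodySolver.Theses.M3PrimeEdgeSplit.LowerEdge_ge_m4o5 := by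
  unfold Summit.Ventures.CertifiedManyBodySolver.Theses.M3PrimeEdgeSplit.LowerEdge_ge_m4o5
    Summit.Ventures.CertifiedManyBodySolver.MbsolverRungLeaves.M3Lower_tp0_ge_m4o5
  exact exists_lowerRow_of_stubs stub_wardWindowSound stub_slackAbsorb stub_nearCert_m4o5

end Summit.Ventures.CertifiedManyBodySolver.Cruxes.LowerEdge_ge_m4o5.FoDualRounding
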